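import Mathlib
import HarnessLib
import Summits.CriticalPhenomena.PercolationContinuityZ3.Theses.PercTreeValue
import Summits.CriticalPhenomena.PercolationContinuityZ3.Theorems.PercTreeValueTetrahedronDisjointCoexistenceStubRestrictProduct
import Summits.CriticalPhenomena.PercolationContinuityZ3.Theorems.PercTreeValueTetrahedronDisjointCoexistenceStubConfineProduct
import Literature.Probability.Percolation.SlabCriticality

/-!
# `stub_shellDecoupling` of line `Sketch` (crux `TetrahedronDisjointCoexistence`,
# stmt-CriticalPhenomena-7798): closed-shell decoupling

Registered stub `stub_shellDecoupling` (S1, the FIRST LEMMA of card `closed-shell-barrier-dichotomy`)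
of the lead's skeleton `Cruxes/TetrahedronDisjointCoexistence/Lines/Sketch.lean`, landed DEF-FREE
over tree declarations, on EVERY countable graph `G` and at EVERY `p`.

Statement: for vertex sets `R ⊆ R'` such that every `G`-neighbour of `R` lies in `R'`, and `W`
disjoint from `R'`, with `P = bondPercolation G p`,
`P(x₁ ↔ y₁ in R) · P(Shell(R, R')) · P(x₂ ↔ y₂ in W) ≤ P(x₁ ↔ y₁, x₂ ↔ y₂, x₁ ↮ x₂)`,
where `Shell(R, R')` is the event "no open path of `R' ∖ R` joins a vertex adjacent to `R` to a
vertex adjacent to `R'ᶜ`".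

Proof.
* Independence. `{x ↔ y in S}` is determined by the pairs `S.sym2` inside `S`
  (`DCT16.determinedBy_openConnIn`); `Shell(R, R')` is a countable intersection of complements of
  such events inside `R' ∖ R` (`shellDecoupling_shell_eq`), hence measurable and determined by
  `(R' ∖ R).sym2`. The vertex sets `R`, `R' ∖ R`, `W` are pairwise disjoint, so are their pair
  sets (`restrictProduct_disjoint_sym2`), and `bondPercolation_real_inter_of_disjoint` (applied
  twice, the second time with `{x₁ ↔ y₁ in R} ∩ Shell` determined by `R'.sym2`) turns the product
  of the three probabilities into the probability of the intersection.
* Inclusion. `P`-a.e. `ω ⊆ E(G)` (`real_preimage_inter_edgeSet`: pull back along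
  `ω ↦ ω ∩ E(G)`). For such `ω` in the intersection, an open path `x₁ → x₂` starts in `R ∋ x₁`
  and ends at `x₂ ∈ W`, `x₂ ∉ R'`; by induction along the walk (`shellDecoupling_walk`) it
  contains a vertex `u ∈ R' ∖ R` adjacent to `R`, a vertex `w ∈ R' ∖ R` adjacent to `R'ᶜ`, and an
  open path `u → w` inside `R' ∖ R` — contradicting `Shell(R, R')`. The other two conjuncts are
  `{x ↔ y in S} ⊆ {x ↔ y}` (`openConnIn_subset_openConn`).
-/

noncomputable section

namespace Summit.CriticalPhenomena.PercolationContinuityZ3.Theorems.TetrahedronDisjointCoexistence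

open MeasureTheory
open Literature.Probability.Percolation Literature.Probability.LatticeModels

variable {V : Type*}

/-- The shell event `Shell(R, R')` as a countable intersection of complements of restricted
connection events: over the vertices `u ∈ R' ∖ R` adjacent to `R` and `w ∈ R' ∖ R` adjacent to
`R'ᶜ`, of `{u ↔ w in R' ∖ R}ᶜ`. -/
theorem shellDecoupling_shell_eq (G : SimpleGraph V) (R R' : Set V) :
    {ω : BondConfig V | ∀ u ∈ R' \ R, ∀ w ∈ R' \ R, (∃ z ∈ R, G.Adj u z) →
        (∃ z ∉ R', G.Adj w z) → ω ∉ openConnIn (R' \ R) u w} =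
      ⋂ u ∈ {u | u ∈ R' \ R ∧ ∃ z ∈ R, G.Adj u z},
        ⋂ w ∈ {w | w ∈ R' \ R ∧ ∃ z ∉ R', G.Adj w z}, (openConnIn (R' \ R) u w)ᶜ := by
  ext ω
  simp only [Set.mem_setOf_eq, Set.mem_iInter, Set.mem_compl_iff]
  exact ⟨fun h u ⟨hu, hz⟩ w ⟨hw, hz'⟩ => h u hu w hw hz hz',
    fun h u hu w hw hz hz' => h u ⟨hu, hz⟩ w ⟨hw, hz'⟩⟩

/-- The shell event `Shell(R, R')` is measurable (`V` countable). -/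
theorem shellDecoupling_measurableSet_shell [Countable V] (G : SimpleGraph V) (R R' : Set V) :
    MeasurableSet {ω : BondConfig V | ∀ u ∈ R' \ R, ∀ w ∈ R' \ R, (∃ z ∈ R, G.Adj u z) →
      (∃ z ∉ R', G.Adj w z) → ω ∉ openConnIn (R' \ R) u w} := by
  rw [shellDecoupling_shell_eq G R R']
  exact MeasurableSet.biInter (Set.to_countable _) fun u _ =>
    MeasurableSet.biInter (Set.to_countable _) fun w _ =>
      (restrictProduct_measurableSet_openConnIn (R' \ R) u w).compl

/-- The shell event `Shell(R, R')` is determined by the pairs inside `R' ∖ R` (and hence by any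
larger set of pairs `K`). -/
theorem shellDecoupling_determinedBy_shell (G : SimpleGraph V) (R R' : Set V) {K : Set (Sym2 V)}
    (hK : (R' \ R).sym2 ⊆ K) :
    DeterminedBy {ω : BondConfig V | ∀ u ∈ R' \ R, ∀ w ∈ R' \ R, (∃ z ∈ R, G.Adj u z) →
      (∃ z ∉ R', G.Adj w z) → ω ∉ openConnIn (R' \ R) u w} K := by
  rw [shellDecoupling_shell_eq G R R']
  exact DeterminedBy.iInter fun u => DeterminedBy.iInter fun _ =>
    DeterminedBy.iInter fun w => DeterminedBy.iInter fun _ =>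
      (DCT16.determinedBy_openConnIn (R' \ R) u w hK).compl

/-- **Walk induction** (last exit from `R`, first exit from `R'`). Let `R ⊆ R'` with every
`G`-neighbour of `R` in `R'`, let `ω ⊆ E(G)`, and let `q` be an open walk from `a` to a vertex
`b ∉ R'`. Write `GOAL` for "some `u ∈ R' ∖ R` adjacent to `R` is joined inside `R' ∖ R` by an
open path to some `w ∈ R' ∖ R` adjacent to `R'ᶜ`". Then: if `a ∈ R`, `GOAL`; and if
`a ∈ R' ∖ R`, either `a` itself is joined inside `R' ∖ R` to some `w ∈ R' ∖ R` adjacent to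
`R'ᶜ`, or `GOAL`. -/
theorem shellDecoupling_walk (G : SimpleGraph V) {R R' : Set V} (hRR' : R ⊆ R')
    (hN : ∀ x ∈ R, ∀ y, G.Adj x y → y ∈ R') {ω : BondConfig V} (hω : ω ⊆ G.edgeSet) {a b : V}
    (q : (openGraph ω).Walk a b) (hb : b ∉ R') :
    (a ∈ R → ∃ u ∈ R' \ R, ∃ w ∈ R' \ R, (∃ z ∈ R, G.Adj u z) ∧ (∃ z ∉ R', G.Adj w z) ∧
        ω ∈ openConnIn (R' \ R) u w) ∧
      (a ∈ R' \ R → (∃ w ∈ R' \ R, (∃ z ∉ R', G.Adj w z) ∧ ω ∈ openConnIn (R' \ R) a w) ∨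
        ∃ u ∈ R' \ R, ∃ w ∈ R' \ R, (∃ z ∈ R, G.Adj u z) ∧ (∃ z ∉ R', G.Adj w z) ∧
          ω ∈ openConnIn (R' \ R) u w) := by
  induction q with
  | nil => exact ⟨fun ha => absurd (hRR' ha) hb, fun ha => absurd ha.1 hb⟩
  | @cons a a' b hadj q ih =>
    have hG : G.Adj a a' :=
      (SimpleGraph.mem_edgeSet G).1 (hω ((openGraph_adj ω a a').1 hadj).1)
    obtain ⟨ih₁, ih₂⟩ := ih hb
    refine ⟨fun ha => ?_, fun ha => ?_⟩
    · -- `a ∈ R`: the next vertex `a'` lies in `R'` (`hN`)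
      have ha'R' : a' ∈ R' := hN a ha a' hG
      by_cases ha'R : a' ∈ R
      · exact ih₁ ha'R
      · rcases ih₂ ⟨ha'R', ha'R⟩ with ⟨w, hw, hz, hconn⟩ | hgoal
        · exact ⟨a', ⟨ha'R', ha'R⟩, w, hw, ⟨a, ha, hG.symm⟩, hz, hconn⟩
        · exact hgoal
    · -- `a ∈ R' ∖ R`
      by_cases ha'R' : a' ∈ R'
      · by_cases ha'R : a' ∈ R
        · exact Or.inr (ih₁ ha'R)
        · rcases ih₂ ⟨ha'R', ha'R⟩ with ⟨w, hw, hz, hconn⟩ | hgoal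
          · obtain ⟨ha', hw', hr⟩ := hconn
            exact Or.inl ⟨w, hw, hz, ha, hw', (SimpleGraph.Adj.reachable
              (show ((openGraph ω).induce (R' \ R)).Adj ⟨a, ha⟩ ⟨a', ha'⟩ from hadj)).trans hr⟩
          · exact Or.inr hgoal
      · -- `a' ∉ R'`: `a` itself is adjacent to `R'ᶜ`
        exact Or.inl ⟨a, ha, ⟨a', ha'R', hG⟩, ha, ha, SimpleGraph.Reachable.refl _⟩

/-- **Pointwise heart.** For a lattice configuration `ω ⊆ E(G)` lying in
`{x₁ ↔ y₁ in R} ∩ Shell(R, R') ∩ {x₂ ↔ y₂ in W}` (`R ⊆ R'`, neighbours of `R` in `R'`,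
`W ∩ R' = ∅`): `x₁ ↔ y₁`, `x₂ ↔ y₂`, and `x₁ ↮ x₂` — an open path from `x₁ ∈ R` to
`x₂ ∈ W ⊆ R'ᶜ` would cross the shell (`shellDecoupling_walk`). -/
theorem shellDecoupling_subset (G : SimpleGraph V) {R R' W : Set V} (hRR' : R ⊆ R')
    (hN : ∀ x ∈ R, ∀ y, G.Adj x y → y ∈ R') (hW : Disjoint R' W) (x₁ y₁ x₂ y₂ : V)
    {ω : BondConfig V} (hω : ω ⊆ G.edgeSet) (h₁ : ω ∈ openConnIn R x₁ y₁)
    (h₂ : ω ∈ {ω : BondConfig V | ∀ u ∈ R' \ R, ∀ w ∈ R' \ R, (∃ z ∈ R, G.Adj u z) →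
      (∃ z ∉ R', G.Adj w z) → ω ∉ openConnIn (R' \ R) u w})
    (h₃ : ω ∈ openConnIn W x₂ y₂) :
    ω ∈ openConn x₁ y₁ ∩ openConn x₂ y₂ ∩ (openConn x₁ x₂)ᶜ := by
  simp only [Set.mem_inter_iff, Set.mem_compl_iff]
  refine ⟨⟨openConnIn_subset_openConn R x₁ y₁ h₁, openConnIn_subset_openConn W x₂ y₂ h₃⟩,
    fun h => ?_⟩
  obtain ⟨hx₁, -, -⟩ := h₁
  obtain ⟨hx₂, -, -⟩ := h₃
  have hx₂' : x₂ ∉ R' := fun h' => Set.disjoint_left.1 hW h' hx₂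
  obtain ⟨q⟩ := (show (openGraph ω).Reachable x₁ x₂ from h)
  obtain ⟨u, hu, w, hw, hz, hz', hconn⟩ := (shellDecoupling_walk G hRR' hN hω q hx₂').1 hx₁
  exact h₂ u hu w hw hz hz' hconn

/-- The pointwise heart pulled back along restriction to the edges of `G` (every `ω ∩ E(G)` is a
lattice configuration). -/
theorem shellDecoupling_preimage_subset (G : SimpleGraph V) {R R' W : Set V} (hRR' : R ⊆ R')
    (hN : ∀ x ∈ R, ∀ y, G.Adj x y → y ∈ R') (hW : Disjoint R' W) (x₁ y₁ x₂ y₂ : V) :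
    (fun ω : BondConfig V => ω ∩ G.edgeSet) ⁻¹'
        (openConnIn R x₁ y₁ ∩
          {ω : BondConfig V | ∀ u ∈ R' \ R, ∀ w ∈ R' \ R, (∃ z ∈ R, G.Adj u z) →
            (∃ z ∉ R', G.Adj w z) → ω ∉ openConnIn (R' \ R) u w} ∩
          openConnIn W x₂ y₂) ⊆
      (fun ω : BondConfig V => ω ∩ G.edgeSet) ⁻¹'
        (openConn x₁ y₁ ∩ openConn x₂ y₂ ∩ (openConn x₁ x₂)ᶜ) := by
  intro ω hω
  simp only [Set.mem_inter_iff, Set.mem_preimage] at hω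
  obtain ⟨⟨h₁, h₂⟩, h₃⟩ := hω
  exact shellDecoupling_subset G hRR' hN hW x₁ y₁ x₂ y₂ Set.inter_subset_right h₁ h₂ h₃

/-- **S1 — closed-shell decoupling** (the FIRST LEMMA of card `closed-shell-barrier-dichotomy`,
on every countable graph and at every `p`). For vertex sets `R ⊆ R'` with every neighbour of `R`
inside `R'`, and `W` disjoint from `R'`:
`P(x₁ ↔ y₁ in R) · P(Shell(R, R')) · P(x₂ ↔ y₂ in W) ≤ P(x₁ ↔ y₁, x₂ ↔ y₂, x₁ ↮ x₂)`, where
`Shell(R, R')` = no open path of `R' ∖ R` from a vertex adjacent to `R` to a vertex adjacent to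
`R'ᶜ`. The three events live on the pairwise disjoint pair sets `R.sym2`, `(R' ∖ R).sym2`,
`W.sym2`, hence are independent (`bondPercolation_real_inter_of_disjoint` twice), and a.s. their
intersection lies in the target (`shellDecoupling_preimage_subset`, `real_preimage_inter_edgeSet`). -/
theorem stub_shellDecoupling {V : Type*} [Countable V] (G : SimpleGraph V) (p : unitInterval)
    {R R' W : Set V} (hRR' : R ⊆ R') (hN : ∀ x ∈ R, ∀ y, G.Adj x y → y ∈ R') (hW : Disjoint R' W)
    (x₁ y₁ x₂ y₂ : V) :
    (bondPercolation G p).real (openConnIn R x₁ y₁) *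
          (bondPercolation G p).real
            {ω | ∀ u ∈ R' \ R, ∀ w ∈ R' \ R, (∃ z ∈ R, G.Adj u z) → (∃ z ∉ R', G.Adj w z) →
              ω ∉ openConnIn (R' \ R) u w} *
        (bondPercolation G p).real (openConnIn W x₂ y₂) ≤
      (bondPercolation G p).real (openConn x₁ y₁ ∩ openConn x₂ y₂ ∩ (openConn x₁ x₂)ᶜ) := by
  -- measurability and supports of the three events
  have hm₁ := restrictProduct_measurableSet_openConnIn (V := V) R x₁ y₁
  have hm₂ := shellDecoupling_measurableSet_shell G R R'
  have hm₃ := restrictProduct_measurableSet_openConnIn (V := V) W x₂ y₂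
  have hA₁ := DCT16.determinedBy_openConnIn R x₁ y₁ (K := R.sym2) le_rfl
  have hA₂ := shellDecoupling_determinedBy_shell G R R' (K := (R' \ R).sym2) le_rfl
  have hA₁₂ := (DCT16.determinedBy_openConnIn R x₁ y₁ (sym2_mono hRR')).inter
    (shellDecoupling_determinedBy_shell G R R' (sym2_mono Set.sdiff_subset))
  have hA₃ := DCT16.determinedBy_openConnIn W x₂ y₂ (K := W.sym2) le_rfl
  have hd₁ : Disjoint R.sym2 (R' \ R).sym2 := restrictProduct_disjoint_sym2 Set.disjoint_sdiff_right
  have hd₂ : Disjoint R'.sym2 W.sym2 := restrictProduct_disjoint_sym2 hW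
  -- a.s. inclusion of the intersection in the target, then independence twice
  have key := measureReal_mono (μ := bondPercolation G p)
    (shellDecoupling_preimage_subset G hRR' hN hW x₁ y₁ x₂ y₂)
  rw [real_preimage_inter_edgeSet, real_preimage_inter_edgeSet,
    bondPercolation_real_inter_of_disjoint G p hd₂ hA₁₂ hA₃ (hm₁.inter hm₂) hm₃,
    bondPercolation_real_inter_of_disjoint G p hd₁ hA₁ hA₂ hm₁ hm₂] at key
  exact key

end Summit.CriticalPhenomena.PercolationContinuityZ3.Theorems.TetrahedronDisjointCoexistence

end
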